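import Summits.QuantumFields.YangMills.Theorems.UnitScaleGibbsBlockPlaquetteStokesLetters
import Literature.MathematicalPhysics.QuantumFieldTheory.Balaban1983to89.T4ExpWindowSmallField
import Literature.MathematicalPhysics.QuantumFieldTheory.Balaban1983to89.UnitaryModel
import HarnessLib

/-!
# S2β · letter (D) REL-TEL of GAP♯∘, the (C)-half (UV3-NODE §75.3 ∕ §75.4 «RELATIVE key lemma», px10 lineage) — BRICK 1:
# RELATIVE NON-ABELIAN STOKES IN RECTANGLES WITH THE COMMUTATOR DEFECT
# `dist1 (U₀(∂R)⁻¹·U(∂R)) ≤ Σ_{p ∈ R} dist1 (U₀(∂p)⁻¹·U(∂p)) + 2·Σ_{p ∈ R} dist1 U(∂p)·(bond deviations along the comb transport to p)`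

Cell `ym3-torus` (rung R3 = continuum `SU(2)` Yang–Mills on the three-torus — NOT d = 4, NOT infinite volume, NOT a mass gap, NOT Clay).
Width seat «width 10» `ym3-torus-px10` (gen 23), FREE px helper on crux `stmt-QuantumFields-20520` (`Theses.UnitScaleTilt.FluctuationComparisonRegPrIntL`),
count-neutral, DEFINITION-FREE; own-risk brick of the px10 lane «(C)-half of letter (D)» (UV3-NODE §75.3: the registered `stub_uniformFibreGapOrbit` ⟸ four letters
{(D), (F)}×{IRR, A′} by ✓`…S2BetaStrataOfLetters`; (D) = relative telescoped road = lift half (px12) + RELATIVE key lemma (this lane) + ✓(iv) recursion).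

THE CURRENCY.  Two configurations `U` (the field) and `U₀` (the background) on `T^{(j)}`, an abstract `GaugeGroup G`.  The tree's relative letters (lit
✓`T4ExpWindowSmallField`): `bdev U U₀ b = U₀(b)⁻¹·U(b)` (bond deviation), and for any two group elements the relative size `dist1 (X₀⁻¹·X)` (for unitary matrices
`= ‖X − X₀‖`); at a plaquette `dist1 (U₀(∂p)⁻¹·U(∂p))` is the `dist1` of the letter `E_p` of ✓`…S2BetaExcessSplit.excess_eq` (`Σ_p dist1(E_p)² = 2·REL`).  The ONE
input beyond the `GaugeGroup` axioms is the COMMUTATOR LETTER `dist1 (g·h·g⁻¹·h⁻¹) ≤ 2·dist1 g·dist1 h`, carried as a HYPOTHESIS `hcomm` on `G` and DISCHARGED here for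
`SU(N)` (§5, `‖[A, B]‖ = ‖[A − 1, B − 1]‖ ≤ 2‖A − 1‖‖B − 1‖`; the `SU(2)` instance is also ✓`…CovariantDischargeFramedPlaquetteTransport.dist1_comm_le`).

CONTENT (all [folklore]; the absolute edition is lit ✓`B10Eq47AxialChi.dist1_rect_le`, [Balaban1985Averaging] (19) p.21, whose induction is followed VERBATIM):
* §1 the δ-calculus: `dist1_rel_comm` (symmetry), `dist1_rel_mul_le` (`δ(XY, X₀Y₀) ≤ δ(X, X₀) + δ(Y, Y₀)`), `dist1_rel_inv`, ★`dist1_rel_conj_le`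
  (`δ(T·p·T⁻¹, T₀·p₀·T₀⁻¹) ≤ δ(p, p₀) + 2·dist1 p·δ(T, T₀)` — the background enters ONLY as SIZE × ARC through the commutator letter).
* §2 relative transports: `dist1_rowProd_rel_le` (`δ` of the straight transports `≤ Σ` bond deviations along the row).
* §3 ★★ RELATIVE STOKES: `dist1_rect_one_rel_le` (strips), ★★`dist1_rect_rel_le` (rectangles `a × b`): constant ONE on the relative plaquettes, plus
  `2·Σ_{t<b} Σ_{s<a} dist1 U(∂p_{s,t})·(Σ_{s′<s} dev⟨x + t e_ν + s′ e_μ, μ⟩ + Σ_{t′<t} dev⟨x + t′ e_ν, ν⟩)` — the deviations of the COMB transports of the induction.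
* §4 sizes: `dist1_rect_rel_le_of_plaqSmall` (under `PlaqSmall θ U`: defect `≤ 2θ·(a·Σ_{rows} dev + a·b·Σ_{spine} dev)`), the square ∕ tent-kernel order
  `dist1_rect_rel_le_sum_square`, and the AXIAL-AVERAGE corollary `dist1_plaqHol_axialAvg_rel_le` (lit ✓`plaqHol_axialAvg_eq_rect`): the relative coarse plaquette of the
  decimation average is bounded by the `L × L` relative fine plaquettes, constant ONE, plus `2·L²θ ×` (comb deviations).
* §5 `dist1_comm_le_SU` — the commutator letter on `SU(N)`.

WHY (the road, not proved here).  The (C)-STEP ✓`…S2BetaOneLevelStep.oneLevelStep` bounds `dist1 Ū(∂Q)` by the tent kernel applied to `dist1 U(∂·)` (MAIN TERM, exact `√L`)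
plus (global θ) × (local sizes); its MAIN TERM is `mean_i dist1 (rect U x_{r(i)} μ ν L L)` (✓`…S2BetaCoupledWordSquare`).  The RELATIVE key lemma of letter (D) needs the same
with `δ` for `dist1`; this brick is the Stokes layer of its main term (BRICK 2 = the tent-kernel block mean of §4, next file); the analytic junk of the (C)-STEP does NOT
transfer verbatim (it is an ABSOLUTE bound) — its Lipschitz edition in the member loops is the named gap of the px10 lane (UV3-NODE § to follow).

HONEST SCOPE.  Group-theoretic bookkeeping (finite inductions, `dist1_conj`, `dist1_mul_le`, one commutator estimate); no analysis; nothing of Bałaban's renormalisation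
analysis is asserted; the relative key lemma, letter (D), letter (F), `hIrr`∕`hA`, GAP♯∘ (`stub_uniformFibreGapOrbit`), S2β, crux 20520 and `YM3TorusSU2` are NOT proved; no
registered stub is closed; the Yang–Mills mass gap is NOT proved.  Sorry-free, axioms standard.
References: T. Bałaban, CMP **98** (1985) 17–51 [Balaban1985Averaging] ((9)–(10) p.19, (19) p.21); CMP **99** (1985) 75–102 [Balaban1985RegularSpaces] (Lemma 1 p.79,
«elementary reasoning» — the printed one-step locus, here in relative currency).
-/

set_option autoImplicit false

noncomputable section

namespace Summit.QuantumFields.YangMills.Theorems.FluctuationComparisonRegPrIntLS2BetaRelativeStokes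

open Finset
open scoped BigOperators
open Literature.MathematicalPhysics.QuantumFieldTheory.Balaban1983to89
open Literature.MathematicalPhysics.QuantumFieldTheory.Balaban1983to89.AveragingRT (axialAvg)
open Literature.MathematicalPhysics.QuantumFieldTheory.Balaban1983to89.T4TiltOscillation (bdev dist1_mul_comm dist1_mul_inv_eq)
open Literature.MathematicalPhysics.QuantumFieldTheory.Balaban1983to89.T4ExpWindowSmallField (dist1_bdev_comm)
open B10Eq47AxialChi (shiftN shiftN_zero shiftN_succ rowProd rowProd_zero rowProd_succ rect rect_one_one dist1_rect_le plaqHol_axialAvg_eq_rect)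
open Summit.QuantumFields.YangMills.Theorems.AvgCurvGrad (shiftN_comm')
open Summit.QuantumFields.YangMills.Theorems.UnitScaleGibbsBlockPlaquetteStokesLetters (rect_succ_left' rect_succ_right')

variable {P : Params} {j : ℕ} {G : Type*} [GaugeGroup G]

/-! ## §1 The δ-calculus: relative sizes `dist1 (X₀⁻¹·X)` -/

/-- Symmetry of the relative size: `dist1 (X₀⁻¹·X) = dist1 (X⁻¹·X₀)`. [folklore] -/
theorem dist1_rel_comm (X X₀ : G) : dist1 (X₀⁻¹ * X) = dist1 (X⁻¹ * X₀) := by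
  rw [← GaugeGroup.dist1_inv (X₀⁻¹ * X), mul_inv_rev, inv_inv]

/-- The relative size read on the right: `dist1 (X·X₀⁻¹) = dist1 (X₀⁻¹·X)`. [folklore] -/
theorem dist1_mul_inv_eq_rel (X X₀ : G) : dist1 (X * X₀⁻¹) = dist1 (X₀⁻¹ * X) := by
  rw [dist1_mul_comm]

/-- ★ **PRODUCTS**: `dist1 ((X₀Y₀)⁻¹·(XY)) ≤ dist1 (X₀⁻¹X) + dist1 (Y₀⁻¹Y)` (cyclicity `dist1 (gh) = dist1 (hg)` + subadditivity). [folklore] -/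
theorem dist1_rel_mul_le (X Y X₀ Y₀ : G) :
    dist1 ((X₀ * Y₀)⁻¹ * (X * Y)) ≤ dist1 (X₀⁻¹ * X) + dist1 (Y₀⁻¹ * Y) := by
  have e : (X₀ * Y₀)⁻¹ * (X * Y) = Y₀⁻¹ * (X₀⁻¹ * X * Y) := by group
  rw [e, dist1_mul_comm, show X₀⁻¹ * X * Y * Y₀⁻¹ = X₀⁻¹ * X * (Y * Y₀⁻¹) by group]
  exact (GaugeGroup.dist1_mul_le _ _).trans (by rw [dist1_mul_inv_eq_rel])

/-- **INVERSES**: `dist1 ((X₀⁻¹)⁻¹·X⁻¹) = dist1 (X₀⁻¹·X)`. [folklore] -/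
theorem dist1_rel_inv (X X₀ : G) : dist1 ((X₀⁻¹)⁻¹ * X⁻¹) = dist1 (X₀⁻¹ * X) := by
  rw [inv_inv, dist1_mul_inv_eq_rel, dist1_rel_comm]

/-- ★ **CONJUGATES — THE COMMUTATOR DEFECT**: under the commutator letter `dist1 (g h g⁻¹ h⁻¹) ≤ 2·dist1 g·dist1 h` on `G`,
`dist1 ((T₀·p₀·T₀⁻¹)⁻¹·(T·p·T⁻¹)) ≤ dist1 (p₀⁻¹·p) + 2·dist1 p·dist1 (T₀⁻¹·T)`: transporting by `T` instead of `T₀` costs (SIZE of the transported element) × (relative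
size of the transports), through one group commutator `p⁻¹·S·p·S⁻¹`, `S = T₀⁻¹T`. [folklore] -/
theorem dist1_rel_conj_le (hcomm : ∀ g h : G, dist1 (g * h * g⁻¹ * h⁻¹) ≤ 2 * dist1 g * dist1 h) (p p₀ T T₀ : G) :
    dist1 ((T₀ * p₀ * T₀⁻¹)⁻¹ * (T * p * T⁻¹)) ≤ dist1 (p₀⁻¹ * p) + 2 * dist1 p * dist1 (T₀⁻¹ * T) := by
  have e : (T₀ * p₀ * T₀⁻¹)⁻¹ * (T * p * T⁻¹) =
      T₀ * (p₀⁻¹ * p * (p⁻¹ * (T₀⁻¹ * T) * (p⁻¹)⁻¹ * (T₀⁻¹ * T)⁻¹)) * T₀⁻¹ := by group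
  rw [e, GaugeGroup.dist1_conj]
  refine (GaugeGroup.dist1_mul_le _ _).trans (add_le_add le_rfl ?_)
  have h := hcomm p⁻¹ (T₀⁻¹ * T)
  rwa [GaugeGroup.dist1_inv] at h

/-! ## §2 Relative straight transports -/

/-- ★ **RELATIVE TRANSPORTS**: `dist1 ((rowProd U₀ x μ n)⁻¹·rowProd U x μ n) ≤ Σ_{s<n} dist1 (bdev U U₀ ⟨x + s e_μ, μ⟩)` — the `rowProd` edition of lit
✓`dist1_wordHol_rel_le` (replace the bond variables one at a time). [folklore] -/
theorem dist1_rowProd_rel_le (U U₀ : GaugeField P j G) (x : Site P j) (μ : Fin P.d) :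
    ∀ n : ℕ, dist1 ((rowProd U₀ x μ n)⁻¹ * rowProd U x μ n) ≤ ∑ s ∈ range n, dist1 (bdev U U₀ ⟨shiftN x μ s, μ⟩)
  | 0 => by simp [GaugeGroup.dist1_one]
  | n + 1 => by
    rw [rowProd_succ, rowProd_succ, Finset.sum_range_succ]
    exact (dist1_rel_mul_le _ _ _ _).trans (add_le_add (dist1_rowProd_rel_le U U₀ x μ n) le_rfl)

/-! ## §3 Relative non-abelian Stokes -/

/-- ★★ **RELATIVE STOKES FOR STRIPS**: `dist1 (U₀(∂R_{a,1})⁻¹·U(∂R_{a,1})) ≤ Σ_{s<a} [dist1 (U₀(∂p_s)⁻¹·U(∂p_s)) + 2·dist1 U(∂p_s)·Σ_{s′<s} dist1 (bdev U U₀ ⟨x + s′e_μ, μ⟩)]`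
(plaquettes `p_s` at `x + s e_μ`, each transported from `x` along the row; constant ONE on the relative plaquettes). [folklore] -/
theorem dist1_rect_one_rel_le (hcomm : ∀ g h : G, dist1 (g * h * g⁻¹ * h⁻¹) ≤ 2 * dist1 g * dist1 h)
    (U U₀ : GaugeField P j G) (x : Site P j) {μ ν : Fin P.d} (h : μ < ν) :
    ∀ a : ℕ, dist1 ((rect U₀ x μ ν a 1)⁻¹ * rect U x μ ν a 1) ≤
      ∑ s ∈ range a, (dist1 ((GaugeField.plaqHol U₀ ⟨shiftN x μ s, μ, ν, h⟩)⁻¹ * GaugeField.plaqHol U ⟨shiftN x μ s, μ, ν, h⟩) +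
        2 * dist1 (GaugeField.plaqHol U ⟨shiftN x μ s, μ, ν, h⟩) * ∑ s' ∈ range s, dist1 (bdev U U₀ ⟨shiftN x μ s', μ⟩))
  | 0 => by simp [rect, rowProd, GaugeGroup.dist1_one]
  | a + 1 => by
    rw [rect_succ_left' U x h a, rect_succ_left' U₀ x h a, Finset.sum_range_succ]
    refine (dist1_rel_mul_le _ _ _ _).trans ?_
    rw [add_comm]
    refine add_le_add (dist1_rect_one_rel_le hcomm U U₀ x h a) ?_
    refine (dist1_rel_conj_le hcomm _ _ _ _).trans (add_le_add le_rfl ?_)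
    exact mul_le_mul_of_nonneg_left (dist1_rowProd_rel_le U U₀ x μ a)
      (mul_nonneg zero_le_two (GaugeGroup.dist1_nonneg _))

/-- ★★ **RELATIVE NON-ABELIAN STOKES ON THE TORUS** for an `a × b` rectangle (`p_{s,t}` the plaquette at `x + t e_ν + s e_μ`, `dev⟨·⟩ := dist1 (bdev U U₀ ·)`):
`dist1 (U₀(∂R_{a,b})⁻¹·U(∂R_{a,b})) ≤ Σ_{t<b} Σ_{s<a} [dist1 (U₀(∂p_{s,t})⁻¹·U(∂p_{s,t})) + 2·dist1 U(∂p_{s,t})·(Σ_{s′<s} dev⟨x + t e_ν + s′e_μ, μ⟩ + Σ_{t′<t} dev⟨x + t′e_ν, ν⟩)]`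
— lit ✓`dist1_rect_le`'s induction with the relative size in place of `dist1`: constant ONE on the relative plaquettes; the background enters ONLY through
(fine plaquette SIZE of `U`) × (bond-deviation ARC along the comb transport of the induction: `t` spine bonds, then `s` row bonds). [folklore] -/
theorem dist1_rect_rel_le (hcomm : ∀ g h : G, dist1 (g * h * g⁻¹ * h⁻¹) ≤ 2 * dist1 g * dist1 h)
    (U U₀ : GaugeField P j G) (x : Site P j) {μ ν : Fin P.d} (h : μ < ν) (a : ℕ) :
    ∀ b : ℕ, dist1 ((rect U₀ x μ ν a b)⁻¹ * rect U x μ ν a b) ≤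
      ∑ t ∈ range b, ∑ s ∈ range a,
        (dist1 ((GaugeField.plaqHol U₀ ⟨shiftN (shiftN x ν t) μ s, μ, ν, h⟩)⁻¹ * GaugeField.plaqHol U ⟨shiftN (shiftN x ν t) μ s, μ, ν, h⟩) +
          2 * dist1 (GaugeField.plaqHol U ⟨shiftN (shiftN x ν t) μ s, μ, ν, h⟩) *
            (∑ s' ∈ range s, dist1 (bdev U U₀ ⟨shiftN (shiftN x ν t) μ s', μ⟩) + ∑ t' ∈ range t, dist1 (bdev U U₀ ⟨shiftN x ν t', ν⟩)))
  | 0 => by simp [rect, rowProd, GaugeGroup.dist1_one]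
  | b + 1 => by
    rw [rect_succ_right' U x μ ν a b, rect_succ_right' U₀ x μ ν a b, Finset.sum_range_succ]
    refine (dist1_rel_mul_le _ _ _ _).trans (add_le_add (dist1_rect_rel_le hcomm U U₀ x h a b) ?_)
    refine (dist1_rel_conj_le hcomm _ _ _ _).trans ?_
    -- the strip at height `b` and the spine transport
    have hstrip := dist1_rect_one_rel_le hcomm U U₀ (shiftN x ν b) h a
    have hsize : dist1 (rect U (shiftN x ν b) μ ν a 1) ≤
        ∑ s ∈ range a, dist1 (GaugeField.plaqHol U ⟨shiftN (shiftN x ν b) μ s, μ, ν, h⟩) := by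
      simpa using dist1_rect_le U (shiftN x ν b) h a 1
    have hspine := dist1_rowProd_rel_le U U₀ x ν b
    have hsp0 : 0 ≤ ∑ t' ∈ range b, dist1 (bdev U U₀ ⟨shiftN x ν t', ν⟩) :=
      Finset.sum_nonneg fun _ _ => GaugeGroup.dist1_nonneg _
    have hd0 : ∀ s, 0 ≤ dist1 (GaugeField.plaqHol U ⟨shiftN (shiftN x ν b) μ s, μ, ν, h⟩) := fun _ => GaugeGroup.dist1_nonneg _
    -- distribute the summand: `Σ_s [δ_s + 2 d_s (A_s + B)] = Σ_s [δ_s + 2 d_s A_s] + (Σ_s 2 d_s)·B`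
    have hsplit : ∑ s ∈ range a,
        (dist1 ((GaugeField.plaqHol U₀ ⟨shiftN (shiftN x ν b) μ s, μ, ν, h⟩)⁻¹ * GaugeField.plaqHol U ⟨shiftN (shiftN x ν b) μ s, μ, ν, h⟩) +
          2 * dist1 (GaugeField.plaqHol U ⟨shiftN (shiftN x ν b) μ s, μ, ν, h⟩) *
            (∑ s' ∈ range s, dist1 (bdev U U₀ ⟨shiftN (shiftN x ν b) μ s', μ⟩) + ∑ t' ∈ range b, dist1 (bdev U U₀ ⟨shiftN x ν t', ν⟩))) =
        ∑ s ∈ range a,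
          (dist1 ((GaugeField.plaqHol U₀ ⟨shiftN (shiftN x ν b) μ s, μ, ν, h⟩)⁻¹ * GaugeField.plaqHol U ⟨shiftN (shiftN x ν b) μ s, μ, ν, h⟩) +
            2 * dist1 (GaugeField.plaqHol U ⟨shiftN (shiftN x ν b) μ s, μ, ν, h⟩) *
              ∑ s' ∈ range s, dist1 (bdev U U₀ ⟨shiftN (shiftN x ν b) μ s', μ⟩)) +
          2 * (∑ s ∈ range a, dist1 (GaugeField.plaqHol U ⟨shiftN (shiftN x ν b) μ s, μ, ν, h⟩)) *
            ∑ t' ∈ range b, dist1 (bdev U U₀ ⟨shiftN x ν t', ν⟩) := by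
      have hB : ∑ s ∈ range a, 2 * dist1 (GaugeField.plaqHol U ⟨shiftN (shiftN x ν b) μ s, μ, ν, h⟩) *
            ∑ t' ∈ range b, dist1 (bdev U U₀ ⟨shiftN x ν t', ν⟩) =
          2 * (∑ s ∈ range a, dist1 (GaugeField.plaqHol U ⟨shiftN (shiftN x ν b) μ s, μ, ν, h⟩)) *
            ∑ t' ∈ range b, dist1 (bdev U U₀ ⟨shiftN x ν t', ν⟩) := by
        rw [← Finset.sum_mul, ← Finset.mul_sum]
      rw [← hB, ← Finset.sum_add_distrib]
      exact Finset.sum_congr rfl fun s _ => by ring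
    rw [hsplit]
    refine add_le_add hstrip ?_
    calc 2 * dist1 (rect U (shiftN x ν b) μ ν a 1) * dist1 ((rowProd U₀ x ν b)⁻¹ * rowProd U x ν b)
        ≤ 2 * (∑ s ∈ range a, dist1 (GaugeField.plaqHol U ⟨shiftN (shiftN x ν b) μ s, μ, ν, h⟩)) *
            ∑ t' ∈ range b, dist1 (bdev U U₀ ⟨shiftN x ν t', ν⟩) := by
          refine mul_le_mul (mul_le_mul_of_nonneg_left hsize zero_le_two) hspine (GaugeGroup.dist1_nonneg _) ?_
          exact mul_nonneg zero_le_two (Finset.sum_nonneg fun s _ => hd0 s)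

/-! ## §4 Sizes: the defect under `PlaqSmall θ U`, the square order, the axial average -/

/-- ★★ **THE DEFECT UNDER A PLAQUETTE BOUND**: if `dist1 U(∂p) ≤ θ` for all `p` (`0 ≤ θ`), then
`dist1 (U₀(∂R_{a,b})⁻¹·U(∂R_{a,b})) ≤ Σ_{t<b} Σ_{s<a} dist1 (U₀(∂p_{s,t})⁻¹·U(∂p_{s,t})) + 2θ·(a·Σ_{t<b} Σ_{s<a} dev⟨x + t e_ν + s e_μ, μ⟩ + a·b·Σ_{t<b} dev⟨x + t e_ν, ν⟩)`
— (SIZE `θ`) × (ARC = the bond deviations on the comb of the rectangle, rows weighted `≤ a`, spine weighted `≤ a·b`). [folklore] -/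
theorem dist1_rect_rel_le_of_le (hcomm : ∀ g h : G, dist1 (g * h * g⁻¹ * h⁻¹) ≤ 2 * dist1 g * dist1 h)
    (U U₀ : GaugeField P j G) {θ : ℝ} (hθ0 : 0 ≤ θ) (hU : ∀ p : Plaq P j, dist1 (GaugeField.plaqHol U p) ≤ θ)
    (x : Site P j) {μ ν : Fin P.d} (h : μ < ν) (a b : ℕ) :
    dist1 ((rect U₀ x μ ν a b)⁻¹ * rect U x μ ν a b) ≤
      ∑ t ∈ range b, ∑ s ∈ range a,
          dist1 ((GaugeField.plaqHol U₀ ⟨shiftN (shiftN x ν t) μ s, μ, ν, h⟩)⁻¹ * GaugeField.plaqHol U ⟨shiftN (shiftN x ν t) μ s, μ, ν, h⟩) +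
        2 * θ * ((a : ℝ) * ∑ t ∈ range b, ∑ s ∈ range a, dist1 (bdev U U₀ ⟨shiftN (shiftN x ν t) μ s, μ⟩) +
          (a : ℝ) * b * ∑ t ∈ range b, dist1 (bdev U U₀ ⟨shiftN x ν t, ν⟩)) := by
  refine (dist1_rect_rel_le hcomm U U₀ x h a b).trans ?_
  have hdev0 : ∀ c : PBond P j, 0 ≤ dist1 (bdev U U₀ c) := fun _ => GaugeGroup.dist1_nonneg _
  -- per-plaquette: `2 d (A_s + B_t) ≤ 2θ (A + B)` with the full row sum `A` and the full spine sum `B`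
  have hpt : ∀ t ∈ range b, ∀ s ∈ range a,
      2 * dist1 (GaugeField.plaqHol U ⟨shiftN (shiftN x ν t) μ s, μ, ν, h⟩) *
          (∑ s' ∈ range s, dist1 (bdev U U₀ ⟨shiftN (shiftN x ν t) μ s', μ⟩) + ∑ t' ∈ range t, dist1 (bdev U U₀ ⟨shiftN x ν t', ν⟩)) ≤
        2 * θ * (∑ s' ∈ range a, dist1 (bdev U U₀ ⟨shiftN (shiftN x ν t) μ s', μ⟩) + ∑ t' ∈ range b, dist1 (bdev U U₀ ⟨shiftN x ν t', ν⟩)) := by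
    intro t ht s hs
    have hs' : range s ⊆ range a := fun c hc => Finset.mem_range.mpr ((Finset.mem_range.mp hc).trans (Finset.mem_range.mp hs))
    have ht' : range t ⊆ range b := fun c hc => Finset.mem_range.mpr ((Finset.mem_range.mp hc).trans (Finset.mem_range.mp ht))
    have hA := Finset.sum_le_sum_of_subset_of_nonneg hs' (fun c _ _ => hdev0 ⟨shiftN (shiftN x ν t) μ c, μ⟩)
    have hB := Finset.sum_le_sum_of_subset_of_nonneg ht' (fun c _ _ => hdev0 ⟨shiftN x ν c, ν⟩)
    have hAB0 : 0 ≤ ∑ s' ∈ range s, dist1 (bdev U U₀ ⟨shiftN (shiftN x ν t) μ s', μ⟩) + ∑ t' ∈ range t, dist1 (bdev U U₀ ⟨shiftN x ν t', ν⟩) :=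
      add_nonneg (Finset.sum_nonneg fun _ _ => hdev0 _) (Finset.sum_nonneg fun _ _ => hdev0 _)
    calc 2 * dist1 (GaugeField.plaqHol U ⟨shiftN (shiftN x ν t) μ s, μ, ν, h⟩) *
          (∑ s' ∈ range s, dist1 (bdev U U₀ ⟨shiftN (shiftN x ν t) μ s', μ⟩) + ∑ t' ∈ range t, dist1 (bdev U U₀ ⟨shiftN x ν t', ν⟩))
        ≤ 2 * θ * (∑ s' ∈ range s, dist1 (bdev U U₀ ⟨shiftN (shiftN x ν t) μ s', μ⟩) + ∑ t' ∈ range t, dist1 (bdev U U₀ ⟨shiftN x ν t', ν⟩)) :=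
          mul_le_mul_of_nonneg_right (mul_le_mul_of_nonneg_left (hU _) zero_le_two) hAB0
      _ ≤ _ := mul_le_mul_of_nonneg_left (add_le_add hA hB) (mul_nonneg zero_le_two hθ0)
  calc ∑ t ∈ range b, ∑ s ∈ range a,
        (dist1 ((GaugeField.plaqHol U₀ ⟨shiftN (shiftN x ν t) μ s, μ, ν, h⟩)⁻¹ * GaugeField.plaqHol U ⟨shiftN (shiftN x ν t) μ s, μ, ν, h⟩) +
          2 * dist1 (GaugeField.plaqHol U ⟨shiftN (shiftN x ν t) μ s, μ, ν, h⟩) *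
            (∑ s' ∈ range s, dist1 (bdev U U₀ ⟨shiftN (shiftN x ν t) μ s', μ⟩) + ∑ t' ∈ range t, dist1 (bdev U U₀ ⟨shiftN x ν t', ν⟩)))
      ≤ ∑ t ∈ range b, ∑ s ∈ range a,
        (dist1 ((GaugeField.plaqHol U₀ ⟨shiftN (shiftN x ν t) μ s, μ, ν, h⟩)⁻¹ * GaugeField.plaqHol U ⟨shiftN (shiftN x ν t) μ s, μ, ν, h⟩) +
          2 * θ * (∑ s' ∈ range a, dist1 (bdev U U₀ ⟨shiftN (shiftN x ν t) μ s', μ⟩) + ∑ t' ∈ range b, dist1 (bdev U U₀ ⟨shiftN x ν t', ν⟩))) :=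
        Finset.sum_le_sum fun t ht => Finset.sum_le_sum fun s hs => add_le_add le_rfl (hpt t ht s hs)
    _ = _ := by
        -- bookkeeping: `Σ_t Σ_s (δ + 2θ(A_t + B)) = ΣΣ δ + 2θ·(a·Σ_t A_t + a·b·B)`
        have h1 : ∀ t : ℕ, ∑ s ∈ range a,
            (dist1 ((GaugeField.plaqHol U₀ ⟨shiftN (shiftN x ν t) μ s, μ, ν, h⟩)⁻¹ * GaugeField.plaqHol U ⟨shiftN (shiftN x ν t) μ s, μ, ν, h⟩) +
              2 * θ * (∑ s' ∈ range a, dist1 (bdev U U₀ ⟨shiftN (shiftN x ν t) μ s', μ⟩) + ∑ t' ∈ range b, dist1 (bdev U U₀ ⟨shiftN x ν t', ν⟩))) =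
            ∑ s ∈ range a, dist1 ((GaugeField.plaqHol U₀ ⟨shiftN (shiftN x ν t) μ s, μ, ν, h⟩)⁻¹ * GaugeField.plaqHol U ⟨shiftN (shiftN x ν t) μ s, μ, ν, h⟩) +
              ((2 * θ * a) * ∑ s' ∈ range a, dist1 (bdev U U₀ ⟨shiftN (shiftN x ν t) μ s', μ⟩) +
                (2 * θ * a) * ∑ t' ∈ range b, dist1 (bdev U U₀ ⟨shiftN x ν t', ν⟩)) := by
          intro t
          rw [Finset.sum_add_distrib, Finset.sum_const, Finset.card_range, nsmul_eq_mul]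
          ring
        rw [Finset.sum_congr rfl fun t _ => h1 t, Finset.sum_add_distrib, Finset.sum_add_distrib, ← Finset.mul_sum, Finset.sum_const,
          Finset.card_range, nsmul_eq_mul]
        ring

/-- ★★ The same under the tree's `PlaqSmall θ U` (strict plaquette bound). [folklore] -/
theorem dist1_rect_rel_le_of_plaqSmall (hcomm : ∀ g h : G, dist1 (g * h * g⁻¹ * h⁻¹) ≤ 2 * dist1 g * dist1 h)
    (U U₀ : GaugeField P j G) {θ : ℝ} (hθ0 : 0 ≤ θ) (hU : PlaqSmall θ U)
    (x : Site P j) {μ ν : Fin P.d} (h : μ < ν) (a b : ℕ) :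
    dist1 ((rect U₀ x μ ν a b)⁻¹ * rect U x μ ν a b) ≤
      ∑ t ∈ range b, ∑ s ∈ range a,
          dist1 ((GaugeField.plaqHol U₀ ⟨shiftN (shiftN x ν t) μ s, μ, ν, h⟩)⁻¹ * GaugeField.plaqHol U ⟨shiftN (shiftN x ν t) μ s, μ, ν, h⟩) +
        2 * θ * ((a : ℝ) * ∑ t ∈ range b, ∑ s ∈ range a, dist1 (bdev U U₀ ⟨shiftN (shiftN x ν t) μ s, μ⟩) +
          (a : ℝ) * b * ∑ t ∈ range b, dist1 (bdev U U₀ ⟨shiftN x ν t, ν⟩)) :=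
  dist1_rect_rel_le_of_le hcomm U U₀ hθ0 (fun p => (hU p).le) x h a b

/-- ★★ **RELATIVE STOKES IN SQUARES in the `(a e_μ, b e_ν)` order** of px12 g23's tent kernel (relative twin of ✓`…S2BetaCoupledWordSquare.dist1_rect_le_sum_square`):
`dist1 (U₀(∂□_L(x))⁻¹·U(∂□_L(x))) ≤ Σ_{a<L} Σ_{b<L} dist1 (U₀(∂⟨x + a e_μ + b e_ν⟩)⁻¹·U(∂⟨…⟩)) + 2θ·(L·Σ_{a,b<L} dev⟨x + a e_μ + b e_ν, μ⟩ + L²·Σ_{b<L} dev⟨x + b e_ν, ν⟩)`. [folklore] -/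
theorem dist1_rect_rel_le_sum_square (hcomm : ∀ g h : G, dist1 (g * h * g⁻¹ * h⁻¹) ≤ 2 * dist1 g * dist1 h)
    (U U₀ : GaugeField P j G) {θ : ℝ} (hθ0 : 0 ≤ θ) (hU : ∀ p : Plaq P j, dist1 (GaugeField.plaqHol U p) ≤ θ)
    (x : Site P j) {μ ν : Fin P.d} (h : μ < ν) :
    dist1 ((rect U₀ x μ ν P.L P.L)⁻¹ * rect U x μ ν P.L P.L) ≤
      ∑ a ∈ range P.L, ∑ b ∈ range P.L,
          dist1 ((GaugeField.plaqHol U₀ ⟨shiftN (shiftN x μ a) ν b, μ, ν, h⟩)⁻¹ * GaugeField.plaqHol U ⟨shiftN (shiftN x μ a) ν b, μ, ν, h⟩) +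
        2 * θ * ((P.L : ℝ) * ∑ a ∈ range P.L, ∑ b ∈ range P.L, dist1 (bdev U U₀ ⟨shiftN (shiftN x μ a) ν b, μ⟩) +
          (P.L : ℝ) ^ 2 * ∑ b ∈ range P.L, dist1 (bdev U U₀ ⟨shiftN x ν b, ν⟩)) := by
  refine (dist1_rect_rel_le_of_le hcomm U U₀ hθ0 hU x h P.L P.L).trans (le_of_eq ?_)
  rw [Finset.sum_comm, sq]
  congr 1
  · exact Finset.sum_congr rfl fun a _ => Finset.sum_congr rfl fun b _ => by rw [shiftN_comm']
  · congr 2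
    rw [Finset.sum_comm]
    exact congrArg _ (Finset.sum_congr rfl fun a _ => Finset.sum_congr rfl fun b _ => by rw [shiftN_comm'])

/-- ★★ **THE RELATIVE COARSE PLAQUETTE OF THE AXIAL (DECIMATION) AVERAGE** (standing range `j + 1 ≤ m + K`; lit ✓`plaqHol_axialAvg_eq_rect`): for `dist1 U(∂p) ≤ θ`,
`dist1 (Ū₀(∂Q)⁻¹·Ū(∂Q)) ≤ Σ_{a,b<L} dist1 (U₀(∂p_{a,b})⁻¹·U(∂p_{a,b})) + 2θ·(L·Σ_{a,b<L} dev⟨emb Q₋ + a e_μ + b e_ν, μ⟩ + L²·Σ_{b<L} dev⟨emb Q₋ + b e_ν, ν⟩)`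
— constant ONE on the `L × L` relative fine plaquettes, plus `(2L²θ) ×` (comb deviations). [cite: Balaban1985Averaging, (19) p.21] -/
theorem dist1_plaqHol_axialAvg_rel_le (hcomm : ∀ g h : G, dist1 (g * h * g⁻¹ * h⁻¹) ≤ 2 * dist1 g * dist1 h)
    (hj : j + 1 ≤ P.m + P.K) (U U₀ : GaugeField P j G) {θ : ℝ} (hθ0 : 0 ≤ θ) (hU : ∀ p : Plaq P j, dist1 (GaugeField.plaqHol U p) ≤ θ)
    (Q : Plaq P (j + 1)) :
    dist1 ((GaugeField.plaqHol (axialAvg U₀) Q)⁻¹ * GaugeField.plaqHol (axialAvg U) Q) ≤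
      ∑ a ∈ range P.L, ∑ b ∈ range P.L,
          dist1 ((GaugeField.plaqHol U₀ ⟨shiftN (shiftN (emb Q.src) Q.μ a) Q.ν b, Q.μ, Q.ν, Q.hμν⟩)⁻¹ *
            GaugeField.plaqHol U ⟨shiftN (shiftN (emb Q.src) Q.μ a) Q.ν b, Q.μ, Q.ν, Q.hμν⟩) +
        2 * θ * ((P.L : ℝ) * ∑ a ∈ range P.L, ∑ b ∈ range P.L, dist1 (bdev U U₀ ⟨shiftN (shiftN (emb Q.src) Q.μ a) Q.ν b, Q.μ⟩) +
          (P.L : ℝ) ^ 2 * ∑ b ∈ range P.L, dist1 (bdev U U₀ ⟨shiftN (emb Q.src) Q.ν b, Q.ν⟩)) := by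
  rw [plaqHol_axialAvg_eq_rect hj, plaqHol_axialAvg_eq_rect hj]
  exact dist1_rect_rel_le_sum_square hcomm U U₀ hθ0 hU (emb Q.src) Q.hμν

/-- The symmetric reading: the defect may be priced with the BACKGROUND's plaquette sizes instead (`dist1 (X₀⁻¹X) = dist1 (X⁻¹X₀)`, `dev` symmetric). [folklore] -/
theorem dist1_rect_rel_le_of_le_background (hcomm : ∀ g h : G, dist1 (g * h * g⁻¹ * h⁻¹) ≤ 2 * dist1 g * dist1 h)
    (U U₀ : GaugeField P j G) {θ : ℝ} (hθ0 : 0 ≤ θ) (hU₀ : ∀ p : Plaq P j, dist1 (GaugeField.plaqHol U₀ p) ≤ θ)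
    (x : Site P j) {μ ν : Fin P.d} (h : μ < ν) (a b : ℕ) :
    dist1 ((rect U₀ x μ ν a b)⁻¹ * rect U x μ ν a b) ≤
      ∑ t ∈ range b, ∑ s ∈ range a,
          dist1 ((GaugeField.plaqHol U₀ ⟨shiftN (shiftN x ν t) μ s, μ, ν, h⟩)⁻¹ * GaugeField.plaqHol U ⟨shiftN (shiftN x ν t) μ s, μ, ν, h⟩) +
        2 * θ * ((a : ℝ) * ∑ t ∈ range b, ∑ s ∈ range a, dist1 (bdev U U₀ ⟨shiftN (shiftN x ν t) μ s, μ⟩) +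
          (a : ℝ) * b * ∑ t ∈ range b, dist1 (bdev U U₀ ⟨shiftN x ν t, ν⟩)) := by
  have h1 := dist1_rect_rel_le_of_le hcomm U₀ U hθ0 hU₀ x h a b
  rw [dist1_rel_comm] at h1
  refine h1.trans (le_of_eq ?_)
  simp only [dist1_rel_comm (GaugeField.plaqHol U _) (GaugeField.plaqHol U₀ _), dist1_bdev_comm U₀ U]

/-! ## §5 The commutator letter on `SU(N)` -/

section SU

open scoped Matrix.Norms.L2Operator

/-- ★ **THE COMMUTATOR LETTER ON `SU(N)`**: `dist1 (g·h·g⁻¹·h⁻¹) ≤ 2·dist1 g·dist1 h` (`dist1 = ‖· − 1‖_{op}` by `rfl`; `g h g⁻¹ h⁻¹ − 1 = (g h − h g)·(h g)⁻¹` and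
`g h − h g = (g − 1)(h − 1) − (h − 1)(g − 1)`, the right factor unitary). [folklore] -/
theorem dist1_comm_le_SU {n : Type*} [Fintype n] [DecidableEq n] [Nonempty n] (a b : Matrix.specialUnitaryGroup n ℂ) :
    dist1 (a * b * a⁻¹ * b⁻¹) ≤ 2 * dist1 a * dist1 b := by
  have hd : ∀ g : Matrix.specialUnitaryGroup n ℂ, dist1 g = ‖(g : Matrix n n ℂ) - 1‖ := fun _ => rfl
  rw [hd, hd a, hd b]
  have hu : ((a⁻¹ : Matrix.specialUnitaryGroup n ℂ) : Matrix n n ℂ) * ((b⁻¹ : Matrix.specialUnitaryGroup n ℂ) : Matrix n n ℂ) ∈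
      Matrix.unitaryGroup n ℂ :=
    mul_mem (Matrix.specialUnitaryGroup_le_unitaryGroup (a⁻¹).2) (Matrix.specialUnitaryGroup_le_unitaryGroup (b⁻¹).2)
  have h1 : (b : Matrix n n ℂ) * (a : Matrix n n ℂ) *
      (((a⁻¹ : Matrix.specialUnitaryGroup n ℂ) : Matrix n n ℂ) * ((b⁻¹ : Matrix.specialUnitaryGroup n ℂ) : Matrix n n ℂ)) = 1 := by
    show ((b * a * (a⁻¹ * b⁻¹) : Matrix.specialUnitaryGroup n ℂ) : Matrix n n ℂ) = 1
    rw [show b * a * (a⁻¹ * b⁻¹) = (1 : Matrix.specialUnitaryGroup n ℂ) by group]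
    rfl
  have e : ((a * b * a⁻¹ * b⁻¹ : Matrix.specialUnitaryGroup n ℂ) : Matrix n n ℂ) - 1 =
      (((a : Matrix n n ℂ) - 1) * ((b : Matrix n n ℂ) - 1) - ((b : Matrix n n ℂ) - 1) * ((a : Matrix n n ℂ) - 1)) *
        (((a⁻¹ : Matrix.specialUnitaryGroup n ℂ) : Matrix n n ℂ) * ((b⁻¹ : Matrix.specialUnitaryGroup n ℂ) : Matrix n n ℂ)) := by
    show (a : Matrix n n ℂ) * (b : Matrix n n ℂ) * ((a⁻¹ : Matrix.specialUnitaryGroup n ℂ) : Matrix n n ℂ) *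
        ((b⁻¹ : Matrix.specialUnitaryGroup n ℂ) : Matrix n n ℂ) - 1 = _
    rw [show (a : Matrix n n ℂ) * (b : Matrix n n ℂ) * ((a⁻¹ : Matrix.specialUnitaryGroup n ℂ) : Matrix n n ℂ) *
          ((b⁻¹ : Matrix.specialUnitaryGroup n ℂ) : Matrix n n ℂ) - 1 =
        (a : Matrix n n ℂ) * (b : Matrix n n ℂ) * ((a⁻¹ : Matrix.specialUnitaryGroup n ℂ) : Matrix n n ℂ) *
            ((b⁻¹ : Matrix.specialUnitaryGroup n ℂ) : Matrix n n ℂ) -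
          (b : Matrix n n ℂ) * (a : Matrix n n ℂ) *
            (((a⁻¹ : Matrix.specialUnitaryGroup n ℂ) : Matrix n n ℂ) * ((b⁻¹ : Matrix.specialUnitaryGroup n ℂ) : Matrix n n ℂ)) by rw [h1]]
    noncomm_ring
  rw [e, CStarRing.norm_mul_mem_unitary _ hu]
  calc ‖((a : Matrix n n ℂ) - 1) * ((b : Matrix n n ℂ) - 1) - ((b : Matrix n n ℂ) - 1) * ((a : Matrix n n ℂ) - 1)‖
      ≤ ‖((a : Matrix n n ℂ) - 1) * ((b : Matrix n n ℂ) - 1)‖ + ‖((b : Matrix n n ℂ) - 1) * ((a : Matrix n n ℂ) - 1)‖ := norm_sub_le _ _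
    _ ≤ ‖(a : Matrix n n ℂ) - 1‖ * ‖(b : Matrix n n ℂ) - 1‖ + ‖(b : Matrix n n ℂ) - 1‖ * ‖(a : Matrix n n ℂ) - 1‖ :=
        add_le_add (norm_mul_le _ _) (norm_mul_le _ _)
    _ = 2 * ‖(a : Matrix n n ℂ) - 1‖ * ‖(b : Matrix n n ℂ) - 1‖ := by ring

end SU

end Summit.QuantumFields.YangMills.Theorems.FluctuationComparisonRegPrIntLS2BetaRelativeStokes

end
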